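import Summits.RiemannHypothesis.RiemannHypothesis.Theorems.Splittings.LiIncrHighPartModelB
import HarnessLib

/-!
# Assembly of stub [β]: the pointwise lower bound for the high part of the Li increment (SketchG6C §9)

Cell rh-split, seat rh-split-li-bridge g6 (brief sha16 f79c5f09d8bcb036), card `run/shared/lean/pub/rh-split/cards/SPLIT-li-bridge.md` §13
(13.5 paper proof «SOUND ON PAPER», referee rh-split-ref g3 06:17:36Z; 13.17); kernel source `HOME/rh-split-li-bridge/SketchG6T.lean` sha16
911a043700f05677 (2287 l; = SketchG6B [γ] ++ SketchG6C [α][β] ++ Part D [δ] ++ Part T, re-pointed at the tree's `LiIncrMeanSquare` /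
`LiIncrBlockLaw`, p508264 / p508611).  Filed by rh-split-typer-2 g4 (lane (xi)(c)–(f)) as a chain of ten tree modules cut at the scratch's
section boundaries, decl text byte-verbatim; deltas = namespaces `RhSplit.LiBridgeG6B/C/D/T` ↦
`…Theorems.Splittings.{LiLowZeroBudget, LiIncrHighPart, LiIncrBlockLawOfRH}` (qualified cross-references rewritten), module docstrings, and
one-line docstrings added where the scratch had none.  END-TO-END statement of the chain (last file):
`LiIncrBlockLawOfRH.rh_iff_almostAllLiMonotone : RiemannHypothesis ↔ ∃ E ⊆ ℕ of natural density zero, ∀ n ≥ 1, n ∉ E → λ_n ≤ λ_{n+1}`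
— T-Li3 IN KERNEL, a RELABELLING of RH (RH-EQUIVALENT, PROVED; certifies nothing about RH; class (li, bridge) unchanged).

This file: §9 `highPart_lower` — the pointwise lower bound `highPart n Y ≥ ½ log n − …` on dyadic blocks (inputs: the tree's explicit `S(t)` bound, window
counts, smooth model integral), and `highPart_lower'`.

Gate dedup delta: the one use of the scratch helper `log_le_self_of_pos` (private in `LiIncrHighPartWeight.lean`) is inlined as
`by linarith [Real.log_le_sub_one_of_pos hY0]`; nothing else differs from the scratch block.

HONEST LABEL: «SPLITTING SEARCH over kernel-typed RH-EQUIVALENCES; a splitting A ∧ B ⟹ RH is CONDITIONAL bookkeeping unless A and B are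
both proved; nothing here bears on the truth of RH.»
-/

set_option linter.dupNamespace false

noncomputable section

namespace Summit.RiemannHypothesis.RiemannHypothesis.Theorems.Splittings.LiIncrHighPart

open Filter Topology Finset Set MeasureTheory
open scoped Real
open Literature.NumberTheory.LFunctions Literature.NumberTheory.LFunctions.SchoenfeldBound
open Literature.NumberTheory.DiophantineGeometry
open Summit.RiemannHypothesis.RiemannHypothesis.Theorems.LiTheory
open Summit.RiemannHypothesis.RiemannHypothesis.Theorems.LiTheory.SmoothReplace
open Summit.RiemannHypothesis.RiemannHypothesis.Theorems.LiTheory.Window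

/-! ## §9 Assembly of stub [β]: the pointwise lower bound for the high part -/

set_option maxHeartbeats 400000 in
/-- **The window right-hand side from below (RH-free):** for `n ≥ 1`, `Y ≥ 30`,
`4Y(log(n+1)+2) ≤ n` and `T' ≥ max(Y, 16(n+3)³)`,
`RHS(T') ≥ ½ log n − n(0.34 log Y + 3.5)/Y² − 8`. -/
theorem window_rhs_lower {n : ℕ} (hn : 1 ≤ n) {Y T' : ℝ} (hY : 30 ≤ Y)
    (hYn : 4 * Y * (Real.log ((n : ℝ) + 1) + 2) ≤ n) (hT : 16 * ((n : ℝ) + 3) ^ 3 ≤ T')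
    (hYT : Y ≤ T') :
    Real.log n / 2 - n * (0.34 * Real.log Y + 3.5) / Y ^ 2 - 8 ≤
      1 / Real.pi * (∫ t in Y..T', incrWeight n t * riemannSiegelThetaDeriv t)
        + zetaArgS T' * incrWeight n T' - zetaArgS Y * incrWeight n Y
        - ∫ t in Y..T', zetaArgS t * incrWeightDeriv n t := by
  have hπ := Real.pi_pos
  have hπ3 := Real.pi_gt_three
  have hn1 : (1 : ℝ) ≤ n := by exact_mod_cast hn
  have hn0 : (0 : ℝ) ≤ n := by linarith
  have hY0 : 0 < Y := by linarith
  have hY1 : 1 ≤ Y := by linarith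
  have hL0 : 0 < Real.log ((n : ℝ) + 1) := Real.log_pos (by linarith)
  have hYn' : Y ≤ n := by nlinarith
  have h2π : 2 * π ≤ Y := by linarith [Real.pi_lt_four]
  -- continuity / integrability of the three pieces
  have hne : ∀ t ∈ uIcc Y T', t ≠ 0 := fun t ht ↦ by
    rw [uIcc_of_le hYT] at ht; linarith [ht.1]
  have hw : ContinuousOn (incrWeight n) (uIcc Y T') := fun t ht ↦
    (hasDerivAt_incrWeight n (hne t ht)).continuousAt.continuousWithinAt
  have hlogc : ContinuousOn (fun t : ℝ ↦ Real.log (t / (2 * π)) / 2) (uIcc Y T') := by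
    refine continuousOn_of_forall_continuousAt fun t ht ↦ ?_
    have : t / (2 * π) ≠ 0 := by
      have : 0 < t := by rw [uIcc_of_le hYT] at ht; linarith [ht.1]
      positivity
    fun_prop (disch := assumption)
  have hmW : ContinuousOn (modelW n) (uIcc Y T') := by
    refine continuousOn_of_forall_continuousAt fun t ht ↦ ?_
    have := hne t ht
    unfold modelW
    fun_prop (disch := assumption)
  have hϑ : Continuous riemannSiegelThetaDeriv := continuous_riemannSiegelThetaDeriv_holds
  have hA : IntervalIntegrable
      (fun t ↦ incrWeight n t * (riemannSiegelThetaDeriv t - Real.log (t / (2 * π)) / 2))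
      volume Y T' := (hw.mul (hϑ.continuousOn.sub hlogc)).intervalIntegrable
  have hB : IntervalIntegrable
      (fun t ↦ (incrWeight n t - modelW n t) * (Real.log (t / (2 * π)) / 2)) volume Y T' :=
    ((hw.sub hmW).mul hlogc).intervalIntegrable
  have hC : IntervalIntegrable (fun t ↦ modelW n t * (Real.log (t / (2 * π)) / 2)) volume Y T' :=
    (hmW.mul hlogc).intervalIntegrable
  have hsplit : ∫ t in Y..T', incrWeight n t * riemannSiegelThetaDeriv t =
      (∫ t in Y..T', incrWeight n t * (riemannSiegelThetaDeriv t - Real.log (t / (2 * π)) / 2))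
      + (∫ t in Y..T', (incrWeight n t - modelW n t) * (Real.log (t / (2 * π)) / 2))
      + ∫ t in Y..T', modelW n t * (Real.log (t / (2 * π)) / 2) := by
    rw [← intervalIntegral.integral_add hA hB, ← intervalIntegral.integral_add (hA.add hB) hC]
    apply intervalIntegral.integral_congr
    intro t _
    ring
  -- the bounds
  have hθ := abs_le.1 (abs_integral_thetaErr_le n hY1 hYT)
  have hM := abs_le.1 (abs_integral_modelErr_le n h2π hYT)
  have hmain := model_main_lower hn hY1 hYn' hT hYT
  have htail := tail_small hn hY1 hYn
  have hΔ := liMainTerm_succ_sub_ge hn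
  have hC1 := liC1_ge
  have htop := abs_le.1 (abs_S_mul_incrWeight_le n (hY.trans hYT))
  have hbot := abs_le.1 (abs_S_mul_incrWeight_le n hY)
  have hS := abs_le.1 (abs_integral_S_mul_incrWeightDeriv_le n hY hYT)
  -- numeric simplifications
  have h4Y : 4 / Y ≤ 4 / 30 := div_le_div_of_nonneg_left (by norm_num) (by norm_num) hY
  have hlogY : Real.log Y ≤ Y := by linarith [Real.log_le_sub_one_of_pos hY0]
  have hlogY0 : 0 ≤ Real.log Y := Real.log_nonneg hY1
  set M : ℝ := (2 * n + 1) * (2 * Real.log Y + 1) / (48 * Y ^ 2) with hMdef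
  have hM0 : 0 ≤ M := by positivity
  have hMle : M / 3 ≤ n * (0.028 * Real.log Y + 0.014) / Y ^ 2 + 0.001 := by
    rw [hMdef]
    have hY2 : (0 : ℝ) < Y ^ 2 := by positivity
    have e1 : (2 * n + 1) * (2 * Real.log Y + 1) / (48 * Y ^ 2) / 3 =
        (n * ((4 * Real.log Y + 2) / 144) + (2 * Real.log Y + 1) / 144) / Y ^ 2 := by
      field_simp
      ring
    rw [e1, div_add' _ _ _ hY2.ne', div_le_div_iff_of_pos_right hY2]
    have h3 : (2 * Real.log Y + 1) / 144 ≤ 0.001 * Y ^ 2 := by nlinarith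
    have h4 : 0 ≤ (n : ℝ) * Real.log Y := mul_nonneg hn0 hlogY0
    linarith
  set A := ∫ t in Y..T', incrWeight n t * (riemannSiegelThetaDeriv t - Real.log (t / (2 * π)) / 2)
  set B := ∫ t in Y..T', (incrWeight n t - modelW n t) * (Real.log (t / (2 * π)) / 2)
  set C := ∫ t in Y..T', modelW n t * (Real.log (t / (2 * π)) / 2)
  have hABC : 1 / π * (A + B + C) ≥
      (liMainTerm (n + 1) - liMainTerm n) - 1 / π * (4 / Y + M + 8) := by
    have h1 : -(4 / Y) - M + (π * (liMainTerm (n + 1) - liMainTerm n) - 8) ≤ A + B + C := by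
      linarith [hθ.1, hM.1]
    have h2 : 1 / π * (-(4 / Y) - M + (π * (liMainTerm (n + 1) - liMainTerm n) - 8)) =
        (liMainTerm (n + 1) - liMainTerm n) - 1 / π * (4 / Y + M + 8) := by
      field_simp
      ring
    have h3 := mul_le_mul_of_nonneg_left h1 (by positivity : (0 : ℝ) ≤ 1 / π)
    linarith
  have hπinv : 1 / π * (4 / Y + M + 8) ≤ 1 / 3 * (4 / Y + M + 8) :=
    mul_le_mul_of_nonneg_right (one_div_le_one_div_of_le (by norm_num) hπ3.le) (by positivity)
  have hpos1 : 0 ≤ (n : ℝ) * Real.log Y / Y ^ 2 := by positivity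
  have hpos2 : 0 ≤ (n : ℝ) / Y ^ 2 := by positivity
  have h5 : liMainTerm (n + 1) - liMainTerm n - 1 / 3 * (4 / Y + M + 8) ≤ 1 / π * (A + B + C) := by
    linarith [hABC, hπinv]
  have h6 : 1 / 3 * (4 / Y + M + 8) ≤
      2.72 + (n * (0.028 * Real.log Y + 0.014) / Y ^ 2 + 0.001) := by
    linarith [h4Y, hMle]
  have h7 : n * (0.028 * Real.log Y + 0.014) / Y ^ 2 + n * (0.3083 * Real.log Y + 3.4) / Y ^ 2
      ≤ n * (0.34 * Real.log Y + 3.5) / Y ^ 2 := by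
    have hY2 : (0 : ℝ) < Y ^ 2 := by positivity
    rw [← add_div, div_le_div_iff_of_pos_right hY2]
    nlinarith [mul_nonneg hn0 hlogY0]
  rw [hsplit]
  linarith [h5, h6, h7, hΔ, hC1, htop.1, hbot.2, hS.2]

/-- **Stub [β] (RH ⟹ pointwise lower bound for the high part):** for `n ≥ 1`, `Y ≥ 30` and
`4Y(log(n+1) + 2) ≤ n`,  `P_Y(n) = highPart n Y ≥ ½ log n − n(0.34 log Y + 3.5)/Y² − 8`.
With `Y² = λN`, `n ∈ [N, 2N)` this is `≥ (½ − 0.34/λ) log N − O_λ(1)`: the block law's third clause. -/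
theorem highPart_lower (hRH : RiemannHypothesis) {n : ℕ} (hn : 1 ≤ n) {Y : ℝ} (hY : 30 ≤ Y)
    (hYn : 4 * Y * (Real.log ((n : ℝ) + 1) + 2) ≤ n) :
    Real.log n / 2 - n * (0.34 * Real.log Y + 3.5) / Y ^ 2 - 8 ≤ highPart n Y := by
  refine highPart_ge_of_eventually hRH hn (by linarith) ?_
  filter_upwards [eventually_ge_atTop (max Y (16 * ((n : ℝ) + 3) ^ 3))] with T' hT'
  exact window_rhs_lower hn hY hYn ((le_max_right _ _).trans hT') ((le_max_left _ _).trans hT')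

/-- The same with the summit spelling `Summit.RiemannHypothesis`. -/
theorem highPart_lower' (hRH : Summit.RiemannHypothesis) {n : ℕ} (hn : 1 ≤ n) {Y : ℝ}
    (hY : 30 ≤ Y) (hYn : 4 * Y * (Real.log ((n : ℝ) + 1) + 2) ≤ n) :
    Real.log n / 2 - n * (0.34 * Real.log Y + 3.5) / Y ^ 2 - 8 ≤ highPart n Y :=
  highPart_lower hRH hn hY hYn

end Summit.RiemannHypothesis.RiemannHypothesis.Theorems.Splittings.LiIncrHighPart

end
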